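import Literature.Computability.AlgebraicComplexity.TypePairConcentration
import Literature.Computability.AlgebraicComplexity.LevelDescent
import Literature.Computability.AlgebraicComplexity.InterfaceBlockCounts
import HarnessLib

/-!
# The fraction of holes of the first type is exponentially small
(Vassilevska Williams–Xu–Xu–Zhou 2024, §6.6, "the fraction of holes caused by the complete split
distributions enforced in the input is 1 − 1/n²") — proved

Topic `Literature/Computability/AlgebraicComplexity`.  §6.6 of Vassilevska Williams–Xu–Xu–Zhou,
*New bounds for matrix multiplication: from alpha to omega* (SODA 2024, arXiv:2307.07970) bounds the
first type of holes of the constituent stage: a uniformly random level-1 `X`-block of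
`𝒯* = ⊗_t ⊗_{(i',j',k')} T_{i',j',k'}^{⊗|S_{t,i',j',k'}|}[β_{X,t,i'j'k'}, …]` (exact split distributions on
the classes `S_{t,i',j',k'}` of half-chunk positions) merges, chunk by chunk (left half in
`S_{t,i',j',k'}`, right half in `S_{t,i_t−i',j_t−j',k_t−k'}`), to a level-1 block of the level-`ℓ` input
whose complete split distribution on the `t`-th term is, with probability `1 − 1/poly(n)`,
`∑_{i',j',k'} α_t(i',j',k') · β_{X,t,i',j',k'} × β_{X,t,i_t−i',j_t−j',k_t−k'} ± o(1) = β_{X,t} ± o(1)`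
("by concentration bounds … Applying concentration bounds again … Summing over all `i', j', k'`"),
hence is NOT zeroed out in the `ε`-interface tensor `𝒯`; "the `o(1)` term can become less than `ε`,
and the `1 − 1/poly(n)` probability can be bounded by `1 − 1/n²` for sufficiently large `n`".

This file PROVES the counting statement behind this paragraph, for a general pair of term maps (the
level-`ℓ` term map `τ` on chunks with data `deg, γ, ε`, and a finer term map `τ'` on half-chunk
positions with exact data `deg', β`, the right class of a chunk being a function `bar` of its term and
left class — in §6, `bar(t, (i',j',k')) = (i_t−i', j_t−j', k_t−k')`):

* `multiTypeClass`, `card_filter_multiTypeClass_two_mul/one_mul` (and `_le`) — **uniformly random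
  blocks restrict to uniformly random independent words on the classes**: for an event depending on the
  restriction to one class (resp. two distinct classes) the fraction of words of a multi-class type
  class in the event is the fraction of words of the type class (resp. pairs of words of the two type
  classes) in it (equicardinal fibres by gluing, `glue₁/glue₂`);
* `admissibleSeqs_zero_eq_multiTypeClass` — the level-1 blocks of an exact interface tensor form a
  multi-class type class;
* `mergeHalves_mem_admissibleSeqs_of_forall_not_pairBad` — **the deterministic step**: if on every
  (term, left class) group of chunks every (left shape, right shape) pair count is within `ε ·`(group
  size) of (group size)`· β_{left}(a) β_{right}(b)`, the merged sequence is `ε`-consistent with the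
  mixture `γ_t = ∑_g (m_{t,g}/n_t) β_g × β_{bar(t,g)}` on every term ("Summing over all `i',j',k'`");
* `card_filter_pairBad_le` — **the probabilistic step**: by `twoWord_pairCount_concentration`
  (left class `≠` right class) or `oneWord_pairCount_concentration` (a self-paired class), the blocks
  with a bad pair count on a group of `m` chunks are a fraction `≤ holePoly(c,n) · e^{−m ε²/32}`;
* `card_mergedHoles_le` — **the bound**: the level-1 blocks of the finer exact tensor whose merge is
  not an `ε`-admissible block of the coarser tensor (the holes of the first type) are a fraction
  `≤ ∑_{(t,g) : m_{t,g} > 0} holePoly(c,n) e^{−m_{t,g} ε²/32}` of all its level-1 blocks — exponentially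
  small in the smallest positive group size, so `≤ 1/n²` for large `n` when the groups have size
  `α_t(i',j',k') A_{t,1} n_t = Θ(n)` (`card_mergedHoles_le_of_le`).

The instantiation to the `𝒯*` of `ConstituentStageData.lean` (classes `S_{t,i',j',k'}`, eq. (14)) is a
direct application and lives next to that file.  Everything here is proved; the definitions are the
ones listed (`classOf`, `multiTypeClass`, `restrictClass`, `glue₁`, `glue₂`, `leftProbes`,
`halfPairCount`, `PairBad`, `mergedHoles`, `holePoly`); no named facts.

## References

* V. Vassilevska Williams, Y. Xu, Z. Xu, R. Zhou, *New bounds for matrix multiplication: from alpha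
  to omega*, SODA 2024, arXiv:2307.07970 (held: `paper:arxiv-2307.07970`), §6.5 (the first type of
  holes) and §6.6 (first four paragraphs). [VassilevskaWilliamsXuXuZhou2024]
* T. M. Cover, J. A. Thomas, *Elements of Information Theory*, 2nd ed., Wiley 2006, §11.1 (method of
  types). [CoverThomas2006]
-/

noncomputable section

open scoped BigOperators
open Finset

namespace Literature.Computability.AlgebraicComplexity

/-! ## Maps with equicardinal fibres preserve fractions -/

section UniformFibres

variable {α ω : Type*} [DecidableEq ω]

/-- **A map with equicardinal fibres preserves fractions**: if `f` maps `S` into `T` and all fibres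
over `T` have the same size, then for every event `Q` on `T`,
`#{a ∈ S | Q (f a)} · #T = #{t ∈ T | Q t} · #S` (the push-forward of the uniform distribution on `S`
is uniform on `T`). [folklore] -/
theorem card_filter_mul_card_of_fibres_eq (S : Finset α) (T : Finset ω) (f : α → ω) (hf : ∀ a ∈ S, f a ∈ T)
    (hfib : ∀ t ∈ T, ∀ t' ∈ T, (S.filter fun a => f a = t).card = (S.filter fun a => f a = t').card)
    (Q : ω → Prop) [DecidablePred Q] :
    (S.filter fun a => Q (f a)).card * T.card = (T.filter Q).card * S.card := by
  rcases T.eq_empty_or_nonempty with hT | ⟨t₀, ht₀⟩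
  · have hS : S = ∅ := by
      rw [Finset.eq_empty_iff_forall_notMem]
      intro a ha
      have := hf a ha
      rw [hT] at this
      exact Finset.notMem_empty _ this
    simp [hS]
  set N := (S.filter fun a => f a = t₀).card with hN
  have hfibN : ∀ t ∈ T, (S.filter fun a => f a = t).card = N := fun t ht => hfib t ht t₀ ht₀
  have hS : S.card = T.card * N := by
    rw [card_eq_sum_card_fiberwise (f := f) (s := S) (t := T) fun a ha => hf a ha, Finset.sum_const_nat hfibN]
  have hSQ : (S.filter fun a => Q (f a)).card = (T.filter Q).card * N := by
    rw [card_eq_sum_card_fiberwise (f := f) (s := S.filter fun a => Q (f a)) (t := T.filter Q) ?_]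
    · refine Finset.sum_const_nat fun t ht => ?_
      rw [mem_filter] at ht
      rw [← hfibN t ht.1, filter_filter]
      congr 1
      ext a
      simp only [mem_filter, and_congr_right_iff]
      intro _
      constructor
      · exact fun h => h.2
      · intro h; exact ⟨h ▸ ht.2, h⟩
    · intro a ha
      have ha' := mem_filter.1 ha
      exact mem_filter.2 ⟨hf a ha'.1, ha'.2⟩
  rw [hSQ, hS]; ring

end UniformFibres

/-! ## Multi-class type classes: words with prescribed letter counts on every class of positions -/

section MultiClass

variable {A X Γ : Type*}

/-- **Restriction of a word to a class** (as a word on the subtype of positions with label `g`). [folklore] -/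
def restrictClass (cls : X → Γ) (g : Γ) (w : X → A) : {x // cls x = g} → A := fun x => w x.1

/-- Entries of the restriction. [folklore] -/
@[simp] theorem restrictClass_apply (cls : X → Γ) (g : Γ) (w : X → A) (x : {x // cls x = g}) :
    restrictClass cls g w x = w x.1 := rfl

section Glue

variable [DecidableEq Γ]

/-! ### Gluing along one class and along two classes -/

/-- **Gluing one class**: the word equal to `v` on the class of `g` and to `w` elsewhere. [folklore] -/
def glue₁ (cls : X → Γ) (g : Γ) (v : {x // cls x = g} → A) (w : X → A) : X → A :=
  fun x => if h : cls x = g then v ⟨x, h⟩ else w x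

/-- The glued word restricts to `v` on the class. [folklore] -/
@[simp] theorem restrictClass_glue₁ (cls : X → Γ) (g : Γ) (v : {x // cls x = g} → A) (w : X → A) :
    restrictClass cls g (glue₁ cls g v w) = v := by
  funext x; simp [glue₁, x.2]

/-- Off the class the glued word is `w`. [folklore] -/
theorem glue₁_apply_of_ne {cls : X → Γ} {g : Γ} (v : {x // cls x = g} → A) (w : X → A) {x : X} (hx : cls x ≠ g) :
    glue₁ cls g v w x = w x := by
  simp [glue₁, hx]

/-- Gluing twice on the same class keeps the last glued pattern. [folklore] -/
theorem glue₁_glue₁ (cls : X → Γ) (g : Γ) (v v' : {x // cls x = g} → A) (w : X → A) :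
    glue₁ cls g v (glue₁ cls g v' w) = glue₁ cls g v w := by
  funext x
  by_cases hx : cls x = g
  · simp [glue₁, hx]
  · simp [glue₁, hx]

/-- Gluing a word's own restriction changes nothing. [folklore] -/
theorem glue₁_restrictClass_self (cls : X → Γ) (g : Γ) (w : X → A) :
    glue₁ cls g (restrictClass cls g w) w = w := by
  funext x
  by_cases hx : cls x = g
  · simp [glue₁, hx]
  · simp [glue₁, hx]

/-- **Gluing two classes**: the word equal to `v₁` on the class of `g₁`, to `v₂` on the class of `g₂`
and to `w` elsewhere. [folklore] -/
def glue₂ (cls : X → Γ) (g₁ g₂ : Γ) (v₁ : {x // cls x = g₁} → A) (v₂ : {x // cls x = g₂} → A) (w : X → A) : X → A :=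
  fun x => if h₁ : cls x = g₁ then v₁ ⟨x, h₁⟩ else if h₂ : cls x = g₂ then v₂ ⟨x, h₂⟩ else w x

/-- The glued word restricts to `v₁` on the first class. [folklore] -/
@[simp] theorem restrictClass_glue₂_left (cls : X → Γ) (g₁ g₂ : Γ) (v₁ : {x // cls x = g₁} → A)
    (v₂ : {x // cls x = g₂} → A) (w : X → A) : restrictClass cls g₁ (glue₂ cls g₁ g₂ v₁ v₂ w) = v₁ := by
  funext x; simp [glue₂, x.2]

/-- The glued word restricts to `v₂` on the second class (distinct from the first). [folklore] -/
theorem restrictClass_glue₂_right (cls : X → Γ) {g₁ g₂ : Γ} (hg : g₁ ≠ g₂) (v₁ : {x // cls x = g₁} → A)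
    (v₂ : {x // cls x = g₂} → A) (w : X → A) : restrictClass cls g₂ (glue₂ cls g₁ g₂ v₁ v₂ w) = v₂ := by
  funext x
  have h2 : cls x.1 = g₂ := x.2
  have h1 : ¬ cls x.1 = g₁ := by rw [h2]; exact fun h => hg h.symm
  simp only [restrictClass_apply, glue₂]
  rw [dif_neg h1, dif_pos h2]

/-- Off the two classes the glued word is `w`. [folklore] -/
theorem glue₂_apply_of_ne {cls : X → Γ} {g₁ g₂ : Γ} (v₁ : {x // cls x = g₁} → A) (v₂ : {x // cls x = g₂} → A) (w : X → A)
    {x : X} (h₁ : cls x ≠ g₁) (h₂ : cls x ≠ g₂) : glue₂ cls g₁ g₂ v₁ v₂ w x = w x := by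
  simp [glue₂, h₁, h₂]

/-- Gluing twice on the same two classes keeps the last glued patterns. [folklore] -/
theorem glue₂_glue₂ (cls : X → Γ) (g₁ g₂ : Γ) (v₁ v₁' : {x // cls x = g₁} → A) (v₂ v₂' : {x // cls x = g₂} → A) (w : X → A) :
    glue₂ cls g₁ g₂ v₁ v₂ (glue₂ cls g₁ g₂ v₁' v₂' w) = glue₂ cls g₁ g₂ v₁ v₂ w := by
  funext x
  by_cases h₁ : cls x = g₁
  · simp [glue₂, h₁]
  · by_cases h₂ : cls x = g₂
    · simp [glue₂, h₂]
    · simp [glue₂, h₁, h₂]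

/-- Gluing a word's own restrictions changes nothing. [folklore] -/
theorem glue₂_restrictClass_self (cls : X → Γ) (g₁ g₂ : Γ) (w : X → A) :
    glue₂ cls g₁ g₂ (restrictClass cls g₁ w) (restrictClass cls g₂ w) w = w := by
  funext x
  by_cases h₁ : cls x = g₁
  · simp [glue₂, h₁]
  · by_cases h₂ : cls x = g₂
    · simp [glue₂, h₂]
    · simp [glue₂, h₁, h₂]

end Glue

section Classes

variable [Fintype X] [DecidableEq Γ]

/-- The class of positions with label `g`. [folklore] -/
abbrev classOf (cls : X → Γ) (g : Γ) : Finset X := univ.filter fun x => cls x = g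

/-- Membership in a class. [folklore] -/
theorem mem_classOf {cls : X → Γ} {g : Γ} {x : X} : x ∈ classOf cls g ↔ cls x = g := by
  simp

/-- `|{x // cls x = g}| = |classOf cls g|`. [folklore] -/
theorem card_subtype_classOf (cls : X → Γ) (g : Γ) : Fintype.card {x // cls x = g} = (classOf cls g).card :=
  Fintype.card_subtype _

variable [DecidableEq A]

/-- Counts on a class are counts of the restriction. [folklore] -/
theorem countOn_classOf_eq (cls : X → Γ) (g : Γ) (w : X → A) (a : A) :
    countOn (classOf cls g) w a = (univ.filter fun x : {x // cls x = g} => restrictClass cls g w x = a).card := by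
  rw [countOn_apply]
  refine card_bij (fun p hp => ⟨p, mem_classOf.1 (mem_filter.1 hp).1⟩) (fun p hp => by simpa using (mem_filter.1 hp).2)
    (fun p₁ _ p₂ _ h => by simpa using congrArg Subtype.val h)
    (fun p hp => ⟨p.1, mem_filter.2 ⟨mem_classOf.2 p.2, by simpa using hp⟩, rfl⟩)

end Classes

section CountCongr

variable [DecidableEq A]

/-- Words agreeing on a set of positions have the same counts there. [folklore] -/
theorem countOn_congr_of_eqOn {P : Finset X} {w w' : X → A} (h : ∀ x ∈ P, w x = w' x) (a : A) :
    countOn P w a = countOn P w' a := by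
  rw [countOn_apply, countOn_apply]
  congr 1
  exact filter_congr fun x hx => by rw [h x hx]

end CountCongr

section MTC

variable [Fintype A] [DecidableEq A] [Fintype X] [DecidableEq X] [Fintype Γ] [DecidableEq Γ]

/-- **The multi-class type class**: the words with letter counts `k g` on the class of `g`, for every
`g` (the level-1 `X`-blocks of an exact interface tensor — on each class `S_{t,i',j',k'}` an arbitrary
word with the prescribed complete split distribution). [cite: VassilevskaWilliamsXuXuZhou2024, §6.6 ("take a random level-1 X-block in 𝒯*")] -/
def multiTypeClass (cls : X → Γ) (k : Γ → A → ℕ) : Finset (X → A) :=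
  univ.filter fun w => ∀ g a, countOn (classOf cls g) w a = k g a

/-- Membership. [folklore] -/
theorem mem_multiTypeClass {cls : X → Γ} {k : Γ → A → ℕ} {w : X → A} :
    w ∈ multiTypeClass cls k ↔ ∀ g a, countOn (classOf cls g) w a = k g a := by
  simp only [multiTypeClass, mem_filter, mem_univ, true_and]

/-- **Restrictions of a multi-class type class lie in the type classes.** [folklore] -/
theorem restrictClass_mem_typeClassOn {cls : X → Γ} {k : Γ → A → ℕ} {w : X → A} (hw : w ∈ multiTypeClass cls k) (g : Γ) :
    restrictClass cls g w ∈ typeClassOn {x // cls x = g} (k g) := by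
  refine mem_typeClassOn.2 fun a => ?_
  rw [← countOn_classOf_eq]
  exact (mem_multiTypeClass.1 hw) g a

/-- The counts of an inhabited multi-class type class on a class sum to the class size. [folklore] -/
theorem sum_eq_card_of_mem_multiTypeClass {cls : X → Γ} {k : Γ → A → ℕ} {w : X → A} (hw : w ∈ multiTypeClass cls k) (g : Γ) :
    ∑ a, k g a = Fintype.card {x // cls x = g} := by
  rw [card_subtype_classOf, ← sum_countOn (classOf cls g) w]
  exact sum_congr rfl fun a _ => ((mem_multiTypeClass.1 hw) g a).symm

/-! ### One class -/

/-- **Gluing a word of the type class into a word of the multi-class type class stays in the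
multi-class type class.** [folklore] -/
theorem glue₁_mem_multiTypeClass {cls : X → Γ} {k : Γ → A → ℕ} {g : Γ} {v : {x // cls x = g} → A}
    (hv : v ∈ typeClassOn {x // cls x = g} (k g)) {w : X → A} (hw : w ∈ multiTypeClass cls k) :
    glue₁ cls g v w ∈ multiTypeClass cls k := by
  refine mem_multiTypeClass.2 fun g' a => ?_
  by_cases hg : g' = g
  · subst hg
    rw [countOn_classOf_eq, restrictClass_glue₁]
    exact (mem_typeClassOn.1 hv) a
  · rw [countOn_congr_of_eqOn (w' := w) (fun x hx => glue₁_apply_of_ne v w (by rw [mem_classOf.1 hx]; exact hg)) a]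
    exact (mem_multiTypeClass.1 hw) g' a

/-- **The fibres of the restriction to one class over the type class are equicardinal** (gluing is a
bijection between any two fibres). [folklore] -/
theorem card_fibre_restrictClass_eq (cls : X → Γ) (k : Γ → A → ℕ) (g : Γ) {v v' : {x // cls x = g} → A}
    (hv : v ∈ typeClassOn {x // cls x = g} (k g)) (hv' : v' ∈ typeClassOn {x // cls x = g} (k g)) :
    ((multiTypeClass cls k).filter fun w => restrictClass cls g w = v).card =
      ((multiTypeClass cls k).filter fun w => restrictClass cls g w = v').card := by
  refine card_nbij' (glue₁ cls g v') (glue₁ cls g v) (fun w hw => ?_) (fun w hw => ?_) (fun w hw => ?_) (fun w hw => ?_)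
  · have hw' := mem_filter.1 (mem_coe.1 hw)
    exact mem_coe.2 (mem_filter.2 ⟨glue₁_mem_multiTypeClass hv' hw'.1, restrictClass_glue₁ _ _ _ _⟩)
  · have hw' := mem_filter.1 (mem_coe.1 hw)
    exact mem_coe.2 (mem_filter.2 ⟨glue₁_mem_multiTypeClass hv hw'.1, restrictClass_glue₁ _ _ _ _⟩)
  · have hw' := mem_filter.1 (mem_coe.1 hw)
    show glue₁ cls g v (glue₁ cls g v' w) = w
    rw [glue₁_glue₁, ← hw'.2, glue₁_restrictClass_self]
  · have hw' := mem_filter.1 (mem_coe.1 hw)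
    show glue₁ cls g v' (glue₁ cls g v w) = w
    rw [glue₁_glue₁, ← hw'.2, glue₁_restrictClass_self]

/-- **One class: the fraction of an event depending on the restriction to a class equals its fraction in
the type class of that class**, `#{w ∈ MTC | P (w|_g)} · #T(g) = #{v ∈ T(g) | P v} · #MTC`.
[cite: VassilevskaWilliamsXuXuZhou2024, §6.6 ("if we take a random level-1 X-block in 𝒯*, the fraction … among the odd positions … by concentration bounds")] -/
theorem card_filter_multiTypeClass_one_mul (cls : X → Γ) (k : Γ → A → ℕ) (g : Γ)
    (P : ({x // cls x = g} → A) → Prop) [DecidablePred P] :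
    ((multiTypeClass cls k).filter fun w => P (restrictClass cls g w)).card * (typeClassOn {x // cls x = g} (k g)).card =
      ((typeClassOn {x // cls x = g} (k g)).filter P).card * (multiTypeClass cls k).card :=
  card_filter_mul_card_of_fibres_eq _ _ (restrictClass cls g) (fun _ hw => restrictClass_mem_typeClassOn hw g)
    (fun _ hv _ hv' => card_fibre_restrictClass_eq cls k g hv hv') P

/-- The inequality form: an event of relative size `≤ B` in the type class has relative size `≤ B` in
the multi-class type class. [folklore] -/
theorem card_filter_multiTypeClass_one_le (cls : X → Γ) (k : Γ → A → ℕ) (g : Γ)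
    (P : ({x // cls x = g} → A) → Prop) [DecidablePred P] {B : ℝ}
    (hP : (((typeClassOn {x // cls x = g} (k g)).filter P).card : ℝ) ≤ B * (typeClassOn {x // cls x = g} (k g)).card) :
    (((multiTypeClass cls k).filter fun w => P (restrictClass cls g w)).card : ℝ) ≤ B * (multiTypeClass cls k).card := by
  have hid := card_filter_multiTypeClass_one_mul cls k g P
  set T := typeClassOn {x // cls x = g} (k g)
  set M := multiTypeClass cls k
  rcases Nat.eq_zero_or_pos T.card with hT | hT
  · -- no word restricts into an empty type class
    have hM : M = ∅ := by
      rw [Finset.eq_empty_iff_forall_notMem]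
      intro w hw
      have hwT : restrictClass cls g w ∈ T := restrictClass_mem_typeClassOn hw g
      rw [Finset.card_eq_zero] at hT
      rw [hT] at hwT
      exact Finset.notMem_empty _ hwT
    simp [hM]
  · have hTR : (0 : ℝ) < T.card := by exact_mod_cast hT
    have hidR : ((M.filter fun w => P (restrictClass cls g w)).card : ℝ) * T.card = (T.filter P).card * M.card := by
      exact_mod_cast hid
    have : ((M.filter fun w => P (restrictClass cls g w)).card : ℝ) = (T.filter P).card * M.card / T.card := by
      rw [eq_div_iff hTR.ne']; exact hidR
    rw [this, div_le_iff₀ hTR]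
    calc ((T.filter P).card : ℝ) * M.card ≤ B * T.card * M.card := by
          exact mul_le_mul_of_nonneg_right hP (Nat.cast_nonneg _)
      _ = B * M.card * T.card := by ring

/-! ### Two distinct classes -/

/-- **Gluing words of the two type classes into a word of the multi-class type class stays in the
multi-class type class.** [folklore] -/
theorem glue₂_mem_multiTypeClass {cls : X → Γ} {k : Γ → A → ℕ} {g₁ g₂ : Γ} (hg : g₁ ≠ g₂)
    {v₁ : {x // cls x = g₁} → A} (hv₁ : v₁ ∈ typeClassOn {x // cls x = g₁} (k g₁))
    {v₂ : {x // cls x = g₂} → A} (hv₂ : v₂ ∈ typeClassOn {x // cls x = g₂} (k g₂))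
    {w : X → A} (hw : w ∈ multiTypeClass cls k) :
    glue₂ cls g₁ g₂ v₁ v₂ w ∈ multiTypeClass cls k := by
  refine mem_multiTypeClass.2 fun g' a => ?_
  by_cases h₁ : g' = g₁
  · subst h₁
    rw [countOn_classOf_eq, restrictClass_glue₂_left]
    exact (mem_typeClassOn.1 hv₁) a
  · by_cases h₂ : g' = g₂
    · subst h₂
      rw [countOn_classOf_eq, restrictClass_glue₂_right cls hg]
      exact (mem_typeClassOn.1 hv₂) a
    · rw [countOn_congr_of_eqOn (w' := w) (fun x hx => glue₂_apply_of_ne v₁ v₂ w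
        (by rw [mem_classOf.1 hx]; exact h₁) (by rw [mem_classOf.1 hx]; exact h₂)) a]
      exact (mem_multiTypeClass.1 hw) g' a

/-- **The fibres of the restriction to two distinct classes over the product of the type classes are
equicardinal.** [folklore] -/
theorem card_fibre_restrictClass₂_eq (cls : X → Γ) (k : Γ → A → ℕ) {g₁ g₂ : Γ} (hg : g₁ ≠ g₂)
    {p p' : ({x // cls x = g₁} → A) × ({x // cls x = g₂} → A)}
    (hp : p ∈ typeClassOn {x // cls x = g₁} (k g₁) ×ˢ typeClassOn {x // cls x = g₂} (k g₂))
    (hp' : p' ∈ typeClassOn {x // cls x = g₁} (k g₁) ×ˢ typeClassOn {x // cls x = g₂} (k g₂)) :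
    ((multiTypeClass cls k).filter fun w => (restrictClass cls g₁ w, restrictClass cls g₂ w) = p).card =
      ((multiTypeClass cls k).filter fun w => (restrictClass cls g₁ w, restrictClass cls g₂ w) = p').card := by
  rw [mem_product] at hp hp'
  refine card_nbij' (glue₂ cls g₁ g₂ p'.1 p'.2) (glue₂ cls g₁ g₂ p.1 p.2) (fun w hw => ?_) (fun w hw => ?_)
    (fun w hw => ?_) (fun w hw => ?_)
  · have hw' := mem_filter.1 (mem_coe.1 hw)
    refine mem_coe.2 (mem_filter.2 ⟨glue₂_mem_multiTypeClass hg hp'.1 hp'.2 hw'.1, ?_⟩)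
    rw [restrictClass_glue₂_left, restrictClass_glue₂_right cls hg]
  · have hw' := mem_filter.1 (mem_coe.1 hw)
    refine mem_coe.2 (mem_filter.2 ⟨glue₂_mem_multiTypeClass hg hp.1 hp.2 hw'.1, ?_⟩)
    rw [restrictClass_glue₂_left, restrictClass_glue₂_right cls hg]
  · have hw' := mem_filter.1 (mem_coe.1 hw)
    have h1 : restrictClass cls g₁ w = p.1 := congrArg Prod.fst hw'.2
    have h2 : restrictClass cls g₂ w = p.2 := congrArg Prod.snd hw'.2
    show glue₂ cls g₁ g₂ p.1 p.2 (glue₂ cls g₁ g₂ p'.1 p'.2 w) = w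
    rw [glue₂_glue₂, ← h1, ← h2, glue₂_restrictClass_self]
  · have hw' := mem_filter.1 (mem_coe.1 hw)
    have h1 : restrictClass cls g₁ w = p'.1 := congrArg Prod.fst hw'.2
    have h2 : restrictClass cls g₂ w = p'.2 := congrArg Prod.snd hw'.2
    show glue₂ cls g₁ g₂ p'.1 p'.2 (glue₂ cls g₁ g₂ p.1 p.2 w) = w
    rw [glue₂_glue₂, ← h1, ← h2, glue₂_restrictClass_self]

/-- **Two distinct classes: the fraction of an event depending on the restrictions to the two classes
equals its fraction in the product of their type classes**,
`#{w ∈ MTC | P (w|_{g₁}, w|_{g₂})} · #(T(g₁) × T(g₂)) = #{p ∈ T(g₁) × T(g₂) | P p} · #MTC` (the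
restrictions of a uniformly random block to two classes are independent uniformly random words).
[cite: VassilevskaWilliamsXuXuZhou2024, §6.6 ("Furthermore, the subset of positions … is also random … Applying concentration bounds again")] -/
theorem card_filter_multiTypeClass_two_mul (cls : X → Γ) (k : Γ → A → ℕ) {g₁ g₂ : Γ} (hg : g₁ ≠ g₂)
    (P : ({x // cls x = g₁} → A) × ({x // cls x = g₂} → A) → Prop) [DecidablePred P] :
    ((multiTypeClass cls k).filter fun w => P (restrictClass cls g₁ w, restrictClass cls g₂ w)).card *
        (typeClassOn {x // cls x = g₁} (k g₁) ×ˢ typeClassOn {x // cls x = g₂} (k g₂)).card =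
      ((typeClassOn {x // cls x = g₁} (k g₁) ×ˢ typeClassOn {x // cls x = g₂} (k g₂)).filter P).card *
        (multiTypeClass cls k).card :=
  card_filter_mul_card_of_fibres_eq _ _ (fun w => (restrictClass cls g₁ w, restrictClass cls g₂ w))
    (fun _ hw => mem_product.2 ⟨restrictClass_mem_typeClassOn hw g₁, restrictClass_mem_typeClassOn hw g₂⟩)
    (fun _ hp _ hp' => card_fibre_restrictClass₂_eq cls k hg hp hp') P

/-- The inequality form for two classes. [folklore] -/
theorem card_filter_multiTypeClass_two_le (cls : X → Γ) (k : Γ → A → ℕ) {g₁ g₂ : Γ} (hg : g₁ ≠ g₂)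
    (P : ({x // cls x = g₁} → A) × ({x // cls x = g₂} → A) → Prop) [DecidablePred P] {B : ℝ}
    (hP : (((typeClassOn {x // cls x = g₁} (k g₁) ×ˢ typeClassOn {x // cls x = g₂} (k g₂)).filter P).card : ℝ) ≤
      B * (typeClassOn {x // cls x = g₁} (k g₁)).card * (typeClassOn {x // cls x = g₂} (k g₂)).card) :
    (((multiTypeClass cls k).filter fun w => P (restrictClass cls g₁ w, restrictClass cls g₂ w)).card : ℝ) ≤
      B * (multiTypeClass cls k).card := by
  have hid := card_filter_multiTypeClass_two_mul cls k hg P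
  set T₁ := typeClassOn {x // cls x = g₁} (k g₁)
  set T₂ := typeClassOn {x // cls x = g₂} (k g₂)
  set M := multiTypeClass cls k
  rcases Nat.eq_zero_or_pos (T₁ ×ˢ T₂).card with hT | hT
  · have hM : M = ∅ := by
      rw [Finset.eq_empty_iff_forall_notMem]
      intro w hw
      have : (restrictClass cls g₁ w, restrictClass cls g₂ w) ∈ T₁ ×ˢ T₂ :=
        mem_product.2 ⟨restrictClass_mem_typeClassOn hw g₁, restrictClass_mem_typeClassOn hw g₂⟩
      rw [Finset.card_eq_zero] at hT
      rw [hT] at this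
      exact Finset.notMem_empty _ this
    simp [hM]
  · have hTR : (0 : ℝ) < (T₁ ×ˢ T₂).card := by exact_mod_cast hT
    have hidR : ((M.filter fun w => P (restrictClass cls g₁ w, restrictClass cls g₂ w)).card : ℝ) * (T₁ ×ˢ T₂).card =
        ((T₁ ×ˢ T₂).filter P).card * M.card := by
      exact_mod_cast hid
    have : ((M.filter fun w => P (restrictClass cls g₁ w, restrictClass cls g₂ w)).card : ℝ) =
        ((T₁ ×ˢ T₂).filter P).card * M.card / (T₁ ×ˢ T₂).card := by
      rw [eq_div_iff hTR.ne']; exact hidR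
    rw [this, div_le_iff₀ hTR]
    have hprod : (((T₁ ×ˢ T₂).card : ℕ) : ℝ) = (T₁.card : ℝ) * T₂.card := by
      rw [card_product, Nat.cast_mul]
    calc (((T₁ ×ˢ T₂).filter P).card : ℝ) * M.card ≤ B * T₁.card * T₂.card * M.card := by
          exact mul_le_mul_of_nonneg_right hP (Nat.cast_nonneg _)
      _ = B * M.card * (T₁ ×ˢ T₂).card := by rw [hprod]; ring

end MTC

end MultiClass

/-! ## The level-1 blocks of an exact interface tensor form a multi-class type class -/

section ExactBlocks

variable {c N s' : ℕ}

/-- **At `ε = 0` the admissible sequences are the multi-class type class of any one of them** (classes =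
the fibres of the term map, counts = its letter counts on them: on an occurring class the complete split
distribution is prescribed exactly, and the level condition follows from the occurrence of each shape).
[cite: VassilevskaWilliamsXuXuZhou2024, Def. 3.4 and §6.6 ("By definition of 𝒯*, the fraction of (î₁,…) in these … positions is β_{X,t,i',j',k'}(î₁,…)")] -/
theorem admissibleSeqs_zero_eq_multiTypeClass (τ' : Fin N → Fin s') (deg' : Fin s' → ℕ)
    (β : Fin s' → (Fin c → Fin 3) → ℝ) {Ih₀ : Fin N → Fin c → Fin 3} (h₀ : Ih₀ ∈ admissibleSeqs τ' deg' β 0) :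
    admissibleSeqs τ' deg' β 0 = multiTypeClass τ' (fun g a => countOn (classOf τ' g) Ih₀ a) := by
  obtain ⟨hlev₀, hsplit₀⟩ := mem_admissibleSeqs.1 h₀
  ext Ih
  rw [mem_admissibleSeqs, mem_multiTypeClass]
  constructor
  · rintro ⟨-, hsplit⟩ g a
    rcases (classOf τ' g).eq_empty_or_nonempty with hge | hgne
    · simp only [countOn_apply, hge, Finset.filter_empty, card_empty]
    · have h1 := hsplit g hgne
      have h2 := hsplit₀ g hgne
      rw [splitConsistentOn_zero_iff] at h1 h2
      have h12 := congrFun (h1.trans h2.symm) a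
      rw [completeSplitOn_apply, completeSplitOn_apply] at h12
      have hc : ((classOf τ' g).card : ℝ) ≠ 0 := by exact_mod_cast hgne.card_pos.ne'
      rw [countOn_apply, countOn_apply]
      exact_mod_cast (div_left_inj' hc).1 h12
  · intro hcnt
    refine ⟨fun p => ?_, fun g hgne => ?_⟩
    · -- the shape `Ih p` occurs in `Ih₀` on the class of `τ' p`
      have hpos : 0 < countOn (classOf τ' (τ' p)) Ih (Ih p) := by
        rw [countOn_apply]; exact card_pos.2 ⟨p, by simp⟩
      rw [hcnt, countOn_apply] at hpos
      obtain ⟨p', hp'⟩ := card_pos.1 hpos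
      rw [mem_filter, mem_classOf] at hp'
      rw [← hp'.2, hlev₀ p', hp'.1]
    · rw [splitConsistentOn_zero_iff]
      have h2 := hsplit₀ g hgne
      rw [splitConsistentOn_zero_iff] at h2
      rw [← h2]
      funext a
      rw [completeSplitOn_apply, completeSplitOn_apply]
      have := hcnt g a
      rw [countOn_apply, countOn_apply] at this
      rw [this]

end ExactBlocks

/-! ## Merging the level-1 blocks of a finer exact tensor: pair counts and the deterministic step -/

section MergeHoles

variable {c n s s' : ℕ} (τ : Fin n → Fin s) (τ' : Fin (n + n) → Fin s')

/-- **The chunks of term `t` whose left half lies in the class `g`** (in §6.6: the level-`ℓ` positions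
of the `t`-th term "where `(i_t,j_t,k_t)` is split into `(i',j',k')` and `(i_t−i',j_t−j',k_t−k')`").
[cite: VassilevskaWilliamsXuXuZhou2024, §6.6] -/
abbrev leftProbes (t : Fin s) (g : Fin s') : Finset (Fin n) := univ.filter fun u => τ u = t ∧ τ' (Fin.castAdd n u) = g

/-- Membership. [folklore] -/
theorem mem_leftProbes {t : Fin s} {g : Fin s'} {u : Fin n} : u ∈ leftProbes τ τ' t g ↔ τ u = t ∧ τ' (Fin.castAdd n u) = g := by
  simp

/-- The groups of chunks of a term partition it: `∑_g m_{t,g} = n_t`. [folklore] -/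
theorem sum_card_leftProbes (t : Fin s) : ∑ g, (leftProbes τ τ' t g).card = (termFibre τ t).card := by
  rw [card_eq_sum_card_fiberwise (f := fun u => τ' (Fin.castAdd n u)) (s := termFibre τ t) (t := univ)
    fun _ _ => mem_univ _]
  refine sum_congr rfl fun g _ => ?_
  rw [filter_filter]

/-- A group of chunks has at most `n` members. [folklore] -/
theorem card_leftProbes_le (t : Fin s) (g : Fin s') : (leftProbes τ τ' t g).card ≤ n := by
  have := card_le_univ (leftProbes τ τ' t g)
  rwa [Fintype.card_fin] at this

/-- **Pair counts of a level-1 sequence on half-chunks**: the number of chunks of term `t` with left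
half in class `g`, left shape `a` and right shape `b` (the empirical distribution of (left half-chunk,
right half-chunk) pairs over these chunks). [cite: VassilevskaWilliamsXuXuZhou2024, §6.6 ("the number of positions that correspond to the level-1 chunk (î₁, …, î_{2^{ℓ−1}})")] -/
def halfPairCount (t : Fin s) (g : Fin s') (Ih : Fin (n + n) → Fin c → Fin 3)
    (ab : (Fin c → Fin 3) × (Fin c → Fin 3)) : ℕ :=
  ((leftProbes τ τ' t g).filter fun u => Ih (Fin.castAdd n u) = ab.1 ∧ Ih (Fin.natAdd n u) = ab.2).card

/-- **A bad pair count** on the group `(t, g)`: some pair count deviates from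
`m_{t,g} · β_g(a) · β_{bar(t,g)}(b)` by at least `ε m_{t,g}` (the complement of the event "the fraction …
is `β_{X,t,i',j',k'}(î₁…) · β_{X,t,i_t−i',…}(î…) ± o(1)`"). [cite: VassilevskaWilliamsXuXuZhou2024, §6.6] -/
abbrev PairBad (ε : ℝ) (β : Fin s' → (Fin c → Fin 3) → ℝ) (bar : Fin s → Fin s' → Fin s') (t : Fin s) (g : Fin s')
    (Ih : Fin (n + n) → Fin c → Fin 3) : Prop :=
  ∃ ab : (Fin c → Fin 3) × (Fin c → Fin 3), ε * (leftProbes τ τ' t g).card ≤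
    |(halfPairCount τ τ' t g Ih ab : ℝ) - (leftProbes τ τ' t g).card * β g ab.1 * β (bar t g) ab.2|

/-- **The holes of the first type, abstractly**: the level-1 blocks of the finer exact tensor
(term map `τ'` on half-chunk positions, data `deg', β`, tolerance `0`) whose merge is not an
`ε`-admissible level-1 block of the coarser tensor (term map `τ` on chunks, data `deg, γ`).
[cite: VassilevskaWilliamsXuXuZhou2024, §6.5 (the first type of holes)] -/
def mergedHoles (deg : Fin s → ℕ) (γ : Fin s → (Fin (c + c) → Fin 3) → ℝ) (ε : ℝ) (deg' : Fin s' → ℕ)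
    (β : Fin s' → (Fin c → Fin 3) → ℝ) : Finset (Fin (n + n) → Fin c → Fin 3) :=
  (admissibleSeqs τ' deg' β 0).filter fun Ih => mergeHalves Ih ∉ admissibleSeqs τ deg γ ε

omit τ τ' in
/-- A concatenated shape is `σ` iff its halves are the halves of `σ`. [folklore] -/
theorem append_eq_iff_halves {α : Type*} (a b : Fin c → α) (σ : Fin (c + c) → α) :
    Fin.append a b = σ ↔ a = leftHalf σ ∧ b = rightHalf σ := by
  constructor
  · rintro rfl; simp
  · rintro ⟨rfl, rfl⟩; exact append_leftHalf_rightHalf σ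

/-- **The merged chunks of term `t` with shape `σ` are counted by the pair counts**, summed over the
left classes: `#{u ∈ τ⁻¹(t) | merge(Î)_u = σ} = ∑_g pairCount_{t,g}(left σ, right σ)` ("Summing over
all `i', j', k'`"). [cite: VassilevskaWilliamsXuXuZhou2024, §6.6] -/
theorem card_filter_mergeHalves_eq_sum (t : Fin s) (Ih : Fin (n + n) → Fin c → Fin 3) (σ : Fin (c + c) → Fin 3) :
    ((termFibre τ t).filter fun u => mergeHalves Ih u = σ).card =
      ∑ g, halfPairCount τ τ' t g Ih (leftHalf σ, rightHalf σ) := by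
  rw [card_eq_sum_card_fiberwise (f := fun u => τ' (Fin.castAdd n u)) (s := (termFibre τ t).filter fun u => mergeHalves Ih u = σ)
    (t := univ) fun _ _ => mem_univ _]
  refine sum_congr rfl fun g _ => ?_
  rw [halfPairCount, filter_filter, filter_filter]
  congr 1
  ext u
  simp only [mem_filter, mem_univ, true_and]
  have h : mergeHalves Ih u = σ ↔ Ih (Fin.castAdd n u) = leftHalf σ ∧ Ih (Fin.natAdd n u) = rightHalf σ :=
    append_eq_iff_halves _ _ σ
  rw [h]
  tauto

/-- **The deterministic step** ("Summing over all `i', j', k'`, … the fraction of level-`ℓ` positions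
with `(î₁,…,î_{2^{ℓ−1}})` is … `β_{X,t}(î₁,…) ± o(1)`"): if the level-`(ℓ−1)` degrees of the two halves
of every chunk add up to its level-`ℓ` degree, the level-`ℓ` distribution of each term is the mixture
`γ_t · n_t = ∑_g m_{t,g} · β_g × β_{bar(t,g)}`, and on every inhabited group `(t,g)` no pair count of
the block `Î` is bad, then the merge of `Î` is an `ε`-admissible level-1 block of the coarser tensor.
[cite: VassilevskaWilliamsXuXuZhou2024, §6.6 (first type of holes, fourth paragraph)] -/
theorem mergeHalves_mem_admissibleSeqs_of_forall_not_pairBad {deg : Fin s → ℕ}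
    {γ : Fin s → (Fin (c + c) → Fin 3) → ℝ} {ε : ℝ} {deg' : Fin s' → ℕ} {β : Fin s' → (Fin c → Fin 3) → ℝ}
    {bar : Fin s → Fin s' → Fin s'}
    (hdeg : ∀ u, deg' (τ' (Fin.castAdd n u)) + deg' (τ' (Fin.natAdd n u)) = deg (τ u))
    (hγ : ∀ t, 0 < (termFibre τ t).card → ∀ σ, γ t σ * (termFibre τ t).card =
      ∑ g, ((leftProbes τ τ' t g).card : ℝ) * β g (leftHalf σ) * β (bar t g) (rightHalf σ))
    {Ih : Fin (n + n) → Fin c → Fin 3} (hIh : Ih ∈ admissibleSeqs τ' deg' β 0)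
    (hgood : ∀ t g, 0 < (leftProbes τ τ' t g).card → ¬ PairBad τ τ' ε β bar t g Ih) :
    mergeHalves Ih ∈ admissibleSeqs τ deg γ ε := by
  rw [mem_admissibleSeqs]
  have hlev := (mem_admissibleSeqs.1 hIh).1
  refine ⟨fun u => ?_, fun t hne σ => ?_⟩
  · show patternLevel (Fin.append (Ih (Fin.castAdd n u)) (Ih (Fin.natAdd n u))) = deg (τ u)
    rw [patternLevel_eq_add, leftHalf_append, rightHalf_append, hlev, hlev, hdeg]
  · have hnt : 0 < (termFibre τ t).card := card_pos.2 hne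
    have hntR : (0 : ℝ) < (termFibre τ t).card := by exact_mod_cast hnt
    -- the count of merged chunks of shape `σ` and its prediction
    set cnt := ((termFibre τ t).filter fun u => mergeHalves Ih u = σ).card with hcnt
    have hcntR : (cnt : ℝ) = ∑ g, (halfPairCount τ τ' t g Ih (leftHalf σ, rightHalf σ) : ℝ) := by
      rw [hcnt, card_filter_mergeHalves_eq_sum]; push_cast; rfl
    have hkey : |(cnt : ℝ) - γ t σ * (termFibre τ t).card| ≤ ε * (termFibre τ t).card := by
      rw [hcntR, hγ t hnt σ, ← sum_sub_distrib]
      refine (abs_sum_le_sum_abs _ _).trans ?_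
      have hsum : ∑ g, ε * ((leftProbes τ τ' t g).card : ℝ) = ε * (termFibre τ t).card := by
        rw [← mul_sum]; congr 1; exact_mod_cast sum_card_leftProbes τ τ' t
      rw [← hsum]
      refine sum_le_sum fun g _ => ?_
      rcases Nat.eq_zero_or_pos (leftProbes τ τ' t g).card with hm | hm
      · -- an empty group: both the count and the prediction vanish
        have h0 : halfPairCount τ τ' t g Ih (leftHalf σ, rightHalf σ) = 0 := by
          rw [halfPairCount, Finset.card_eq_zero.1 hm, Finset.filter_empty, card_empty]
        rw [h0, hm]; simp
      · have hg := hgood t g hm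
        simp only [PairBad, not_exists, not_le] at hg
        exact (hg (leftHalf σ, rightHalf σ)).le
    -- divide by `n_t`
    have hsplit : completeSplitOn (mergeHalves Ih) (univ.filter fun u => τ u = t) σ = (cnt : ℝ) / (termFibre τ t).card := by
      rw [completeSplitOn_apply]
    rw [hsplit]
    have e : (cnt : ℝ) / (termFibre τ t).card - γ t σ = ((cnt : ℝ) - γ t σ * (termFibre τ t).card) / (termFibre τ t).card := by
      field_simp
    rw [e, abs_div, abs_of_pos hntR, div_le_iff₀ hntR]
    exact hkey

end MergeHoles

/-! ## The probabilistic step and the bound -/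

section Bound

variable {c n s s' : ℕ} (τ : Fin n → Fin s) (τ' : Fin (n + n) → Fin s')

omit τ τ' in
/-- The number of chunk shapes one level down: `|{0,1,2}^c| = 3^c`. [folklore] -/
theorem card_halfShapes : Fintype.card (Fin c → Fin 3) = 3 ^ c := by
  simp

/-- **The polynomial factor** of the hole bound: `(1 + 9^c) (2n+1)^{3^c} (2n+1)^{3^c}` (dominating the
polynomial factors of both concentration bounds, with `m ≤ n` probes and classes of `≤ 2n` positions).
[cite: VassilevskaWilliamsXuXuZhou2024, §6.6 ("with 1 − 1/poly(n) probability")] -/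
def holePoly (c n : ℕ) : ℝ := (1 + ((3 : ℝ) ^ c) ^ 2) * ((((n : ℝ) + n) + 1) ^ (3 ^ c) * (((n : ℝ) + n) + 1) ^ (3 ^ c))

omit τ τ' in
/-- `holePoly ≥ 0`. [folklore] -/
theorem holePoly_nonneg (c n : ℕ) : 0 ≤ holePoly c n := by
  unfold holePoly; positivity

omit τ τ' in
/-- Cardinality of a filter of the subtype of a finset. [folklore] -/
theorem card_filter_univ_coe {α : Type*} (S : Finset α) (Q : α → Prop) [DecidablePred Q] :
    (univ.filter fun u : ↥S => Q u.1).card = (S.filter Q).card := by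
  refine card_bij (fun u _ => u.1) (fun u hu => mem_filter.2 ⟨u.2, (mem_filter.1 hu).2⟩)
    (fun u _ u' _ h => Subtype.ext h) (fun a ha => ⟨⟨a, (mem_filter.1 ha).1⟩, mem_filter.2 ⟨mem_univ _, (mem_filter.1 ha).2⟩, rfl⟩)

/-- **The probabilistic step**: on an inhabited group `(t,g)` of `m` chunks the level-1 blocks of the
finer exact tensor with a bad pair count are a fraction `≤ holePoly(c,n) · e^{−m ε²/32}` of all its
level-1 blocks — by `twoWord_pairCount_concentration` when the right class `bar(t,g)` differs from `g`
(two independent uniformly random words) and by `oneWord_pairCount_concentration` when `bar(t,g) = g`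
(one word, left and right halves at disjoint positions), transported to the multi-class type class of
blocks (`card_filter_multiTypeClass_two_le/one_le`). [cite: VassilevskaWilliamsXuXuZhou2024, §6.6 ("with 1 − 1/poly(n) probability, by concentration bounds … Applying concentration bounds again"); CoverThomas2006, Thm. 11.1.4] -/
theorem card_filter_pairBad_le {ε : ℝ} (hε : 0 < ε) (deg' : Fin s' → ℕ) (β : Fin s' → (Fin c → Fin 3) → ℝ)
    {bar : Fin s → Fin s' → Fin s'} (hbar : ∀ u, τ' (Fin.natAdd n u) = bar (τ u) (τ' (Fin.castAdd n u)))
    (t : Fin s) (g : Fin s') (hm : 0 < (leftProbes τ τ' t g).card) :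
    ((((admissibleSeqs τ' deg' β 0).filter fun Ih => PairBad τ τ' ε β bar t g Ih)).card : ℝ) ≤
      holePoly c n * Real.exp (-((leftProbes τ τ' t g).card * ε ^ 2 / 32)) * (admissibleSeqs τ' deg' β 0).card := by
  classical
  set blocks := admissibleSeqs τ' deg' β 0 with hblocks
  rcases blocks.eq_empty_or_nonempty with hbe | ⟨Ih₀, h₀⟩
  · simp [hbe]
  -- the blocks are the multi-class type class of `Ih₀`
  set k₀ : Fin s' → (Fin c → Fin 3) → ℕ := fun g a => countOn (classOf τ' g) Ih₀ a with hk₀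
  have hMTC : blocks = multiTypeClass τ' k₀ := admissibleSeqs_zero_eq_multiTypeClass τ' deg' β h₀
  have hIh₀M : Ih₀ ∈ multiTypeClass τ' k₀ := hMTC ▸ h₀
  -- the group, its left class `g` and its right class `bar t g`
  set m := (leftProbes τ τ' t g).card with hmdef
  obtain ⟨u₀, hu₀⟩ := card_pos.1 hm
  rw [mem_leftProbes] at hu₀
  have hcls_ne : ∀ g', (∃ x, τ' x = g') → ∀ a, ((k₀ g' a : ℕ) : ℝ) / (Fintype.card {x // τ' x = g'} : ℕ) = β g' a := by
    rintro g' ⟨x, hx⟩ a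
    have hne : (classOf τ' g').Nonempty := ⟨x, mem_classOf.2 hx⟩
    have h2 := (mem_admissibleSeqs.1 h₀).2 g' hne
    rw [splitConsistentOn_zero_iff] at h2
    have := congrFun h2 a
    rw [completeSplitOn_apply] at this
    rw [card_subtype_classOf]
    show ((countOn (classOf τ' g') Ih₀ a : ℕ) : ℝ) / ((classOf τ' g').card : ℕ) = β g' a
    rw [countOn_apply]
    exact this
  have hβg : ∀ a, ((k₀ g a : ℕ) : ℝ) / (Fintype.card {x // τ' x = g} : ℕ) = β g a :=
    hcls_ne g ⟨Fin.castAdd n u₀, hu₀.2⟩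
  have hbar₀ : τ' (Fin.natAdd n u₀) = bar t g := by rw [hbar u₀, hu₀.1, hu₀.2]
  have hβbar : ∀ b, ((k₀ (bar t g) b : ℕ) : ℝ) / (Fintype.card {x // τ' x = bar t g} : ℕ) = β (bar t g) b :=
    hcls_ne (bar t g) ⟨Fin.natAdd n u₀, hbar₀⟩
  have hk : ∀ g', ∑ a, k₀ g' a = Fintype.card {x // τ' x = g'} := fun g' => sum_eq_card_of_mem_multiTypeClass hIh₀M g'
  -- the probes
  set U := ↥(leftProbes τ τ' t g)
  have hUm : Fintype.card U = m := by rw [hmdef]; exact Fintype.card_coe _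
  have hU : 0 < Fintype.card U := by rw [hUm]; exact hm
  let ℓ : U ↪ {x // τ' x = g} := ⟨fun u => ⟨Fin.castAdd n u.1, (mem_leftProbes τ τ'|>.1 u.2).2⟩, fun u u' h => by
    apply Subtype.ext
    have := congrArg (fun x : {x // τ' x = g} => (x.1 : ℕ)) h
    simp only [Fin.val_castAdd] at this
    exact Fin.ext this⟩
  have hℓ : ∀ u : U, ((ℓ u : {x // τ' x = g}) : Fin (n + n)) = Fin.castAdd n u.1 := fun u => rfl
  -- sizes entering the polynomial factors
  have hA : Fintype.card (Fin c → Fin 3) = 3 ^ c := card_halfShapes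
  have hm1 : ((Fintype.card U : ℝ) + 1) ≤ ((n : ℝ) + n) + 1 := by
    rw [hUm]
    have : (m : ℝ) ≤ n := by exact_mod_cast card_leftProbes_le τ τ' t g
    linarith
  have hC1 : ∀ g', ((Fintype.card {x // τ' x = g'} : ℝ) + 1) ≤ ((n : ℝ) + n) + 1 := by
    intro g'
    have : Fintype.card {x // τ' x = g'} ≤ n + n := by
      have := Fintype.card_subtype_le (fun x : Fin (n + n) => τ' x = g')
      rwa [Fintype.card_fin] at this
    have : (Fintype.card {x // τ' x = g'} : ℝ) ≤ (n : ℝ) + n := by exact_mod_cast this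
    linarith
  have hU0 : (0 : ℝ) ≤ (Fintype.card U : ℝ) + 1 := by positivity
  have hexp : Real.exp (-(Fintype.card U * ε ^ 2 / 8)) ≤ Real.exp (-((m : ℝ) * ε ^ 2 / 32)) := by
    rw [hUm, Real.exp_le_exp]
    have : (0 : ℝ) ≤ (m : ℝ) * ε ^ 2 := by positivity
    linarith
  have hexp32 : Real.exp (-(Fintype.card U * ε ^ 2 / 32)) = Real.exp (-((m : ℝ) * ε ^ 2 / 32)) := by rw [hUm]
  have hpow_m : ((Fintype.card U : ℝ) + 1) ^ Fintype.card (Fin c → Fin 3) ≤ (((n : ℝ) + n) + 1) ^ (3 ^ c) := by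
    rw [hA]; exact pow_le_pow_left₀ hU0 hm1 _
  have hpow_C : ∀ g', ((Fintype.card {x // τ' x = g'} : ℝ) + 1) ^ Fintype.card (Fin c → Fin 3) ≤ (((n : ℝ) + n) + 1) ^ (3 ^ c) := by
    intro g'; rw [hA]; exact pow_le_pow_left₀ (by positivity) (hC1 g') _
  have hA2 : (Fintype.card (Fin c → Fin 3) : ℝ) ^ 2 = ((3 : ℝ) ^ c) ^ 2 := by rw [hA]; push_cast; ring
  by_cases hgg : g = bar t g
  · -- one word: left and right halves in the same class, at disjoint positions
    let r : U ↪ {x // τ' x = g} := ⟨fun u => ⟨Fin.natAdd n u.1, by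
        rw [hbar u.1, (mem_leftProbes τ τ'|>.1 u.2).1, (mem_leftProbes τ τ'|>.1 u.2).2]; exact hgg.symm⟩,
      fun u u' h => by
        apply Subtype.ext
        have := congrArg (fun x : {x // τ' x = g} => (x.1 : ℕ)) h
        simp only [Fin.val_natAdd] at this
        exact Fin.ext (by omega)⟩
    have hr : ∀ u : U, ((r u : {x // τ' x = g}) : Fin (n + n)) = Fin.natAdd n u.1 := fun u => rfl
    have hdisj : ∀ u u' : U, ℓ u ≠ r u' := by
      intro u u' h
      have := congrArg (fun x : {x // τ' x = g} => ((x.1 : Fin (n + n)) : ℕ)) h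
      simp only [hℓ, hr, Fin.val_castAdd, Fin.val_natAdd] at this
      have := u.1.isLt
      omega
    have hconc := oneWord_pairCount_concentration (k₀ g) (hk g) ℓ r hdisj hU hε
    -- the event, as a predicate on the restriction to the class of `g`
    set P : ({x // τ' x = g} → (Fin c → Fin 3)) → Prop := fun w => ∃ ab : (Fin c → Fin 3) × (Fin c → Fin 3),
      ε * Fintype.card U ≤ |(pairCount ℓ r w w ab : ℝ) -
        Fintype.card U * ((k₀ g ab.1 : ℝ) / Fintype.card {x // τ' x = g}) * ((k₀ g ab.2 : ℝ) / Fintype.card {x // τ' x = g})|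
      with hP
    set B : ℝ := holePoly c n * Real.exp (-((m : ℝ) * ε ^ 2 / 32)) with hB
    have hbound : (((typeClassOn {x // τ' x = g} (k₀ g)).filter P).card : ℝ) ≤ B * (typeClassOn {x // τ' x = g} (k₀ g)).card := by
      refine hconc.trans ?_
      rw [hB, hexp32]
      refine mul_le_mul_of_nonneg_right ?_ (Nat.cast_nonneg _)
      refine mul_le_mul_of_nonneg_right ?_ (Real.exp_nonneg _)
      rw [holePoly, hA2, mul_assoc]
      refine mul_le_mul_of_nonneg_left ?_ (by positivity)
      exact mul_le_mul hpow_m (hpow_C g) (by positivity) (by positivity)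
    have h1 := card_filter_multiTypeClass_one_le τ' k₀ g P hbound
    -- identify the event with `PairBad`
    have hEq : blocks.filter (fun Ih => PairBad τ τ' ε β bar t g Ih) =
        (multiTypeClass τ' k₀).filter fun w => P (restrictClass τ' g w) := by
      rw [hMTC]
      refine filter_congr fun w _ => ?_
      have hpc : ∀ ab : (Fin c → Fin 3) × (Fin c → Fin 3),
          pairCount ℓ r (restrictClass τ' g w) (restrictClass τ' g w) ab = halfPairCount τ τ' t g w ab := by
        intro ab
        rw [pairCount, halfPairCount]
        exact card_filter_univ_coe (leftProbes τ τ' t g) (fun u => w (Fin.castAdd n u) = ab.1 ∧ w (Fin.natAdd n u) = ab.2)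
      simp only [PairBad, hP, hpc, hUm, hβg, ← hgg, ← hmdef]
    rw [hEq, hMTC]
    rw [hB] at h1
    exact h1
  · -- two words: left halves in the class of `g`, right halves in the class of `bar t g ≠ g`
    let r : U ↪ {x // τ' x = bar t g} := ⟨fun u => ⟨Fin.natAdd n u.1, by
        rw [hbar u.1, (mem_leftProbes τ τ'|>.1 u.2).1, (mem_leftProbes τ τ'|>.1 u.2).2]⟩,
      fun u u' h => by
        apply Subtype.ext
        have := congrArg (fun x : {x // τ' x = bar t g} => (x.1 : ℕ)) h
        simp only [Fin.val_natAdd] at this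
        exact Fin.ext (by omega)⟩
    have hconc := twoWord_pairCount_concentration (k₀ g) (k₀ (bar t g)) (hk g) (hk (bar t g)) ℓ r hU hε
    set P : ({x // τ' x = g} → (Fin c → Fin 3)) × ({x // τ' x = bar t g} → (Fin c → Fin 3)) → Prop := fun w =>
      ∃ ab : (Fin c → Fin 3) × (Fin c → Fin 3), ε * Fintype.card U ≤ |(pairCount ℓ r w.1 w.2 ab : ℝ) -
        Fintype.card U * ((k₀ g ab.1 : ℝ) / Fintype.card {x // τ' x = g}) *
          ((k₀ (bar t g) ab.2 : ℝ) / Fintype.card {x // τ' x = bar t g})| with hP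
    set B : ℝ := holePoly c n * Real.exp (-((m : ℝ) * ε ^ 2 / 32)) with hB
    have hbound : (((typeClassOn {x // τ' x = g} (k₀ g) ×ˢ typeClassOn {x // τ' x = bar t g} (k₀ (bar t g))).filter P).card : ℝ) ≤
        B * (typeClassOn {x // τ' x = g} (k₀ g)).card * (typeClassOn {x // τ' x = bar t g} (k₀ (bar t g))).card := by
      refine hconc.trans ?_
      rw [hB]
      refine mul_le_mul_of_nonneg_right ?_ (Nat.cast_nonneg _)
      refine mul_le_mul_of_nonneg_right ?_ (Nat.cast_nonneg _)
      refine mul_le_mul ?_ hexp (Real.exp_nonneg _) (holePoly_nonneg c n)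
      rw [holePoly, hA2]
      calc ((Fintype.card U : ℝ) + 1) ^ Fintype.card (Fin c → Fin 3) *
            (((Fintype.card {x // τ' x = g} : ℝ) + 1) ^ Fintype.card (Fin c → Fin 3) +
              ((3 : ℝ) ^ c) ^ 2 * ((Fintype.card {x // τ' x = bar t g} : ℝ) + 1) ^ Fintype.card (Fin c → Fin 3))
          ≤ (((n : ℝ) + n) + 1) ^ (3 ^ c) * ((((n : ℝ) + n) + 1) ^ (3 ^ c) + ((3 : ℝ) ^ c) ^ 2 * (((n : ℝ) + n) + 1) ^ (3 ^ c)) := by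
            refine mul_le_mul hpow_m (add_le_add (hpow_C g) (mul_le_mul_of_nonneg_left (hpow_C (bar t g)) (by positivity)))
              (by positivity) (by positivity)
        _ = (1 + ((3 : ℝ) ^ c) ^ 2) * ((((n : ℝ) + n) + 1) ^ (3 ^ c) * (((n : ℝ) + n) + 1) ^ (3 ^ c)) := by ring
    have h2 := card_filter_multiTypeClass_two_le τ' k₀ hgg P hbound
    have hEq : blocks.filter (fun Ih => PairBad τ τ' ε β bar t g Ih) =
        (multiTypeClass τ' k₀).filter fun w => P (restrictClass τ' g w, restrictClass τ' (bar t g) w) := by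
      rw [hMTC]
      refine filter_congr fun w _ => ?_
      have hpc : ∀ ab : (Fin c → Fin 3) × (Fin c → Fin 3),
          pairCount ℓ r (restrictClass τ' g w) (restrictClass τ' (bar t g) w) ab = halfPairCount τ τ' t g w ab := by
        intro ab
        rw [pairCount, halfPairCount]
        exact card_filter_univ_coe (leftProbes τ τ' t g) (fun u => w (Fin.castAdd n u) = ab.1 ∧ w (Fin.natAdd n u) = ab.2)
      simp only [PairBad, hP, hpc, hUm, hβg, hβbar, ← hmdef]
    rw [hEq, hMTC]
    rw [hB] at h2
    exact h2

/-- **The bound on the holes of the first type** ("a random level-1 `X`-block appears in `𝒯` with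
probability at least `1 − 1/n²`", in counting form with explicit error): the level-1 blocks of the finer
exact tensor whose merge is not an `ε`-admissible level-1 block of the coarser tensor are at most
`(∑_{(t,g) : m_{t,g} > 0} holePoly(c,n) · e^{−m_{t,g} ε²/32}) ·` (all level-1 blocks).
Hypotheses: the degrees of the two halves of every chunk add up (`hdeg`: the level-`(ℓ−1)` triple is
inside the level-`ℓ` blocks), the right class of a chunk is `bar` of its term and left class (`hbar`:
the right split type is `(i_t−i', j_t−j', k_t−k')`), and each level-`ℓ` distribution is the mixture of
products (`hγ`: eq. (14), `β_{X,t} = ∑ α_t(i',j',k') β_{X,t,i'j'k'} × β_{X,t,i_t−i',…}`).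
[cite: VassilevskaWilliamsXuXuZhou2024, §6.6 (first type of holes: "the fraction of holes caused by the complete split distributions enforced in the input")] -/
theorem card_mergedHoles_le {deg : Fin s → ℕ} {γ : Fin s → (Fin (c + c) → Fin 3) → ℝ} {ε : ℝ} (hε : 0 < ε)
    {deg' : Fin s' → ℕ} {β : Fin s' → (Fin c → Fin 3) → ℝ} {bar : Fin s → Fin s' → Fin s'}
    (hdeg : ∀ u, deg' (τ' (Fin.castAdd n u)) + deg' (τ' (Fin.natAdd n u)) = deg (τ u))
    (hbar : ∀ u, τ' (Fin.natAdd n u) = bar (τ u) (τ' (Fin.castAdd n u)))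
    (hγ : ∀ t, 0 < (termFibre τ t).card → ∀ σ, γ t σ * (termFibre τ t).card =
      ∑ g, ((leftProbes τ τ' t g).card : ℝ) * β g (leftHalf σ) * β (bar t g) (rightHalf σ)) :
    ((mergedHoles τ τ' deg γ ε deg' β).card : ℝ) ≤
      (∑ t, ∑ g, if 0 < (leftProbes τ τ' t g).card then
          holePoly c n * Real.exp (-((leftProbes τ τ' t g).card * ε ^ 2 / 32)) else 0) *
        (admissibleSeqs τ' deg' β 0).card := by
  classical
  set blocks := admissibleSeqs τ' deg' β 0 with hblocks
  set groups := (univ : Finset (Fin s × Fin s')).filter fun tg => 0 < (leftProbes τ τ' tg.1 tg.2).card with hgroups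
  -- a hole has a bad pair count on some inhabited group
  have hcover : mergedHoles τ τ' deg γ ε deg' β ⊆
      groups.biUnion fun tg => blocks.filter fun Ih => PairBad τ τ' ε β bar tg.1 tg.2 Ih := by
    intro Ih hIh
    rw [mergedHoles, mem_filter] at hIh
    obtain ⟨hb, hnot⟩ := hIh
    by_contra hcon
    refine hnot (mergeHalves_mem_admissibleSeqs_of_forall_not_pairBad τ τ' hdeg hγ hb fun t g hm hbad => ?_)
    exact hcon (mem_biUnion.2 ⟨(t, g), mem_filter.2 ⟨mem_univ _, hm⟩, mem_filter.2 ⟨hb, hbad⟩⟩)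
  have h1 : ((mergedHoles τ τ' deg γ ε deg' β).card : ℝ) ≤
      ∑ tg ∈ groups, (((blocks.filter fun Ih => PairBad τ τ' ε β bar tg.1 tg.2 Ih)).card : ℝ) := by
    have := (card_le_card hcover).trans card_biUnion_le
    exact_mod_cast this
  refine h1.trans ?_
  calc ∑ tg ∈ groups, (((blocks.filter fun Ih => PairBad τ τ' ε β bar tg.1 tg.2 Ih)).card : ℝ)
      ≤ ∑ tg ∈ groups, holePoly c n * Real.exp (-((leftProbes τ τ' tg.1 tg.2).card * ε ^ 2 / 32)) * blocks.card := by
        refine sum_le_sum fun tg htg => ?_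
        exact card_filter_pairBad_le τ τ' hε deg' β hbar tg.1 tg.2 (mem_filter.1 htg).2
    _ = (∑ tg ∈ groups, holePoly c n * Real.exp (-((leftProbes τ τ' tg.1 tg.2).card * ε ^ 2 / 32))) * blocks.card := by
        rw [sum_mul]
    _ = (∑ t, ∑ g, if 0 < (leftProbes τ τ' t g).card then
          holePoly c n * Real.exp (-((leftProbes τ τ' t g).card * ε ^ 2 / 32)) else 0) * blocks.card := by
        congr 1
        rw [hgroups, sum_filter, Fintype.sum_prod_type]

/-- **Uniform version**: if every inhabited group has at least `m₀` chunks, the holes of the first type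
are at most `s s' · holePoly(c,n) · e^{−m₀ ε²/32} ·` (all level-1 blocks) — exponentially small in `m₀`,
so `≤ (1/n²) ·` (all blocks) for `n` large when `m₀ = Θ(n)` ("the `1 − 1/poly(n)` probability can be
bounded by `1 − 1/n²` for sufficiently large `n`"). [cite: VassilevskaWilliamsXuXuZhou2024, §6.6] -/
theorem card_mergedHoles_le_of_le {deg : Fin s → ℕ} {γ : Fin s → (Fin (c + c) → Fin 3) → ℝ} {ε : ℝ} (hε : 0 < ε)
    {deg' : Fin s' → ℕ} {β : Fin s' → (Fin c → Fin 3) → ℝ} {bar : Fin s → Fin s' → Fin s'}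
    (hdeg : ∀ u, deg' (τ' (Fin.castAdd n u)) + deg' (τ' (Fin.natAdd n u)) = deg (τ u))
    (hbar : ∀ u, τ' (Fin.natAdd n u) = bar (τ u) (τ' (Fin.castAdd n u)))
    (hγ : ∀ t, 0 < (termFibre τ t).card → ∀ σ, γ t σ * (termFibre τ t).card =
      ∑ g, ((leftProbes τ τ' t g).card : ℝ) * β g (leftHalf σ) * β (bar t g) (rightHalf σ))
    (m₀ : ℕ) (hm₀ : ∀ t g, 0 < (leftProbes τ τ' t g).card → m₀ ≤ (leftProbes τ τ' t g).card) :
    ((mergedHoles τ τ' deg γ ε deg' β).card : ℝ) ≤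
      (s : ℝ) * s' * holePoly c n * Real.exp (-((m₀ : ℝ) * ε ^ 2 / 32)) * (admissibleSeqs τ' deg' β 0).card := by
  refine (card_mergedHoles_le τ τ' hε hdeg hbar hγ).trans (mul_le_mul_of_nonneg_right ?_ (Nat.cast_nonneg _))
  have hterm : ∀ t g, (if 0 < (leftProbes τ τ' t g).card then
      holePoly c n * Real.exp (-((leftProbes τ τ' t g).card * ε ^ 2 / 32)) else 0) ≤
        holePoly c n * Real.exp (-((m₀ : ℝ) * ε ^ 2 / 32)) := by
    intro t g
    split_ifs with h
    · refine mul_le_mul_of_nonneg_left ?_ (holePoly_nonneg c n)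
      rw [Real.exp_le_exp]
      have : (m₀ : ℝ) ≤ (leftProbes τ τ' t g).card := by exact_mod_cast hm₀ t g h
      have hε2 : 0 ≤ ε ^ 2 := by positivity
      nlinarith
    · exact mul_nonneg (holePoly_nonneg c n) (Real.exp_nonneg _)
  calc ∑ t, ∑ g, (if 0 < (leftProbes τ τ' t g).card then
          holePoly c n * Real.exp (-((leftProbes τ τ' t g).card * ε ^ 2 / 32)) else 0)
      ≤ ∑ _t : Fin s, ∑ _g : Fin s', holePoly c n * Real.exp (-((m₀ : ℝ) * ε ^ 2 / 32)) :=
        sum_le_sum fun t _ => sum_le_sum fun g _ => hterm t g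
    _ = (s : ℝ) * s' * holePoly c n * Real.exp (-((m₀ : ℝ) * ε ^ 2 / 32)) := by
        simp only [sum_const, card_univ, Fintype.card_fin, nsmul_eq_mul]; ring

end Bound

end Literature.Computability.AlgebraicComplexity
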